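import Summits.HodgeConjecture.HodgeConjecture.Cruxes.BlochSeedDiscOne.DeepLayerLaws

/-!
line stmt-HodgeConjecture-18881 Cruxes/BlochSeedDiscOne/Lines/birth.lean 814a6a70c14e831a stub_rung_pad4_seedAt

# ThreadCollapse — the typed (pen-provable) half of the THREAD-COLLAPSE law of the coarse RULE-D room
(plan-lens-HodgeAV-extremal g23; claim-free; kit 0; memo `Cruxes/BlochSeedDiscOne/THREAD-COLLAPSE-extremal-g23.md`.)

LETTER-MODEL BOOKKEEPING ONLY (`DepthBoundA4.Design`, door (H2) = `LeggedFloor.RuleD ∕ RuleDP`): a design is not a sheaf, not a display, not a SEED;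
NOTHING here is proved toward HC ∕ HC_CM ∕ HC_AV ∕ №4 ∕ 26512 ∕ 18881 ∕ H2 ∕ any `S⁺`.  No `instance`, no notation, no `axiom`, no `sorry`,
no `native_decide`; imports the tree module `DeepLayerLaws` (names `TouchesN ∕ TouchesP ∕ RingLe`, helper lemmas `ruleDP_any`,
`hub_pair_of_not_detects`) and restates nothing under a second name.

## What is proved (hypothesis-free implications about the typed letter model; no `Disj`, no ring hypothesis, no `0 < c` needed)
§1 `not_detects_of_not_touchesN` ∕ `eq_hub_of_not_touchesN`: `RuleDP` alone — if NO supported N-cell carries a letter of co-level `c`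
   (`¬ TouchesN c D`), then a supported P-cell carrying a co-level-`c` letter at slot `f` has NO detecting block avoiding `f`; on the alphabet
   its three other letters are HUBS.  (Pen: a detecting block `(g, j)` with `f ∉ {g, j}` has an N supplier equal to the P-cell OFF the block,
   hence carrying the co-level-`c` letter.)
§2 `supplier_shape_of_not_touchesN`: under the same hypothesis every RULE-D supplier `y` of such a P-cell `x` through a block `(f, j)` is
   `y j' = hub` for all `j' ≠ f` and `NullStep (x f) (y f)` (strictly shallower, null-related at `f`): the co-level-`c` layer of the design is
   then «P (X, hub, hub, hub) fed by N (X⁻, hub, hub, hub)» and nothing else.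
§3 `topP_three_hubs_of_not_touchesN_ceiling`: the instance at the CEILING `c` of a `RingLe c` room, packaged with (E) of `DeepLayerLaws`
   (`touchesP_of_touchesN'` is the converse direction: an N-letter at the ceiling forces a P-letter there).

## What is NOT proved here (computed, memo §3–§5): the N half — in the coarse S₄-orbit RULE-D room on the shell-`s` alphabet (h = 14), the
supported N-cells carrying a column-`s` letter are exactly the THREAD cells «X_s Y HH» (Y an axis letter of a lower column) and «X_s HHH»
(regimes strict ∕ B ∕ W4), and killing them (plus the hub-free cells carrying a column-`s` letter, in regimes that have any) collapses the
shell-`s` room onto the shell-`(s−1)` room REP FOR REP, s = 4 … 9 — a finite certified computation (C engine `gfp23.c`, tables and SHA-256 in the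
memo), stated there as the conjecture (TC)_s for all s; this file types only the half that has a four-line pen proof.
-/

set_option linter.dupNamespace false
set_option autoImplicit false

namespace Summit.HodgeConjecture.HodgeConjecture.Cruxes.BlochSeedDiscOne.ThreadCollapse

open Summit.HodgeConjecture.HodgeConjecture.Cruxes.BlochSeedDiscOne.DepthBoundA4
open Summit.HodgeConjecture.HodgeConjecture.Cruxes.BlochSeedDiscOne.LeggedFloor
open Summit.HodgeConjecture.HodgeConjecture.Cruxes.BlochSeedDiscOne.DeepLayerLaws

/-! ## §1 No N-letter at co-level `c` ⇒ a P-cell touching `c` detects only through its co-level-`c` slot -/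

/-- four slots: away from any two there is a third. -/
theorem exists_third_slot (f j : Fin 4) : ∃ g : Fin 4, g ≠ f ∧ g ≠ j := by
  revert f j
  decide

/-- **(P-TOP, block form).**  `RuleDP` and no supported N-cell with a co-level-`c` letter: a supported P-cell with a co-level-`c` letter at `f`
has no detecting block avoiding `f`. -/
theorem not_detects_of_not_touchesN {D : Design} (hr : RuleDP D) {c : ℤ} (hN : ¬ TouchesN c D)
    {x : Cell} (hx : x ∈ D.suppP) {f : Fin 4} (hf : (x f).colevel = c)
    {g j : Fin 4} (hgj : g ≠ j) (hg : g ≠ f) (hj : j ≠ f) : ¬ Detects x g j := by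
  intro hdet
  obtain ⟨y, hy, hs⟩ := ruleDP_any hr hx hgj hdet
  have e : x f = y f := hs.1 f (Ne.symm hg) (Ne.symm hj)
  exact hN ⟨y, hy, f, by rw [← e]; exact hf⟩

/-- **(P-TOP, letter form).**  On the alphabet, the three other letters of such a P-cell are hubs. -/
theorem eq_hub_of_not_touchesN {h : ℤ} {D : Design} (hA : D.OnAlphabet h) (hr : RuleDP D) {c : ℤ} (hN : ¬ TouchesN c D)
    {x : Cell} (hx : x ∈ D.suppP) {f : Fin 4} (hf : (x f).colevel = c) {j : Fin 4} (hj : j ≠ f) :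
    x j = Letter.hub h := by
  obtain ⟨g, hgf, hgj⟩ := exists_third_slot f j
  have hnd : ¬ Detects x j g := not_detects_of_not_touchesN hr hN hx hf (Ne.symm hgj) hj hgf
  exact (hub_pair_of_not_detects (hA x (mem_supp_of_memP D hx)) hnd).1

/-- the same with `RuleD` (both clauses) in the hypothesis, for citation convenience. -/
theorem eq_hub_of_not_touchesN' {h : ℤ} {D : Design} (hA : D.OnAlphabet h) (hr : RuleD D) {c : ℤ} (hN : ¬ TouchesN c D)
    {x : Cell} (hx : x ∈ D.suppP) {f : Fin 4} (hf : (x f).colevel = c) {j : Fin 4} (hj : j ≠ f) :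
    x j = Letter.hub h :=
  eq_hub_of_not_touchesN hA hr.2 hN hx hf hj

/-- such a P-cell still DETECTS through every block containing `f` as soon as `0 < c` (its slot-`f` letter is not the hub). -/
theorem detects_top_slot {h : ℤ} {D : Design} (hA : D.OnAlphabet h) {c : ℤ} (hc : 0 < c)
    {x : Cell} (hx : x ∈ D.suppP) {f : Fin 4} (hf : (x f).colevel = c) (j : Fin 4) : Detects x f j := by
  intro hnd
  have h0 : (x f).colevel = 0 := (colevel_eq_zero_iff (x f)).mpr ⟨hnd.1, hnd.2.1⟩
  have _ := hA x (mem_supp_of_memP D hx) f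
  omega

/-! ## §2 The suppliers of such a P-cell: N (X⁻, hub, hub, hub) with a NULL step at the top slot -/

/-- no letter of the alphabet is null-BELOW the hub (a null step strictly raises the level `a`, and `a ≤ h` on the alphabet). -/
theorem not_nullStep_hub {h : ℤ} {ℓ : Letter} (hℓ : ℓ.OnAlphabet h) : ¬ NullStep (Letter.hub h) ℓ := by
  intro hn
  have h1 := hn.1
  have h2 := level_le_of_onAlphabet hℓ
  simp only [Letter.hub] at h1
  omega

/-- **(SUPPLIER SHAPE).**  `RuleDP`, alphabet, `¬ TouchesN c D`: if `y` is a supported N-cell supplying the P-cell `x` (co-level-`c` letter at `f`,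
hubs elsewhere by §1) through a block `(f, j)` or `(j, f)`, then `y` has hubs at every slot `≠ f` and a NULL step `x f → y f` at `f`
(so `(y f).colevel < c`: the supplier lives strictly below the co-level-`c` layer). -/
theorem supplier_shape_of_not_touchesN {h : ℤ} {D : Design} (hA : D.OnAlphabet h) (hr : RuleDP D) {c : ℤ} (hN : ¬ TouchesN c D)
    {x : Cell} (hx : x ∈ D.suppP) {f : Fin 4} (hf : (x f).colevel = c)
    {y : Cell} (hy : y ∈ D.suppN) {j : Fin 4} (hjf : j ≠ f) (hs : Supplies x y f j ∨ Supplies x y j f) :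
    (∀ j' : Fin 4, j' ≠ f → y j' = Letter.hub h) ∧ NullStep (x f) (y f) := by
  have hyA : ∀ g : Fin 4, (y g).OnAlphabet h := hA y (mem_supp_of_memN D hy)
  have hubx : ∀ j' : Fin 4, j' ≠ f → x j' = Letter.hub h := fun j' hj' => eq_hub_of_not_touchesN hA hr hN hx hf hj'
  -- the slot-`f` alternative `x f = y f` is excluded by `¬ TouchesN`
  have topf : ∀ (e : x f = y f ∨ NullStep (x f) (y f)), NullStep (x f) (y f) := by
    intro e
    rcases e with e | e
    · exact absurd ⟨y, hy, f, by rw [← e]; exact hf⟩ hN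
    · exact e
  -- the slot-`j` alternative `NullStep (x j) (y j)` is excluded: `x j` is the hub
  have atj : ∀ (e : x j = y j ∨ NullStep (x j) (y j)), y j = Letter.hub h := by
    intro e
    rcases e with e | e
    · rw [← e]; exact hubx j hjf
    · rw [hubx j hjf] at e; exact absurd e (not_nullStep_hub (hyA j))
  rcases hs with hs | hs
  · obtain ⟨hoff, ef, ej⟩ := hs
    refine ⟨fun j' hj' => ?_, topf ef⟩
    by_cases hjj : j' = j
    · subst hjj; exact atj ej
    · rw [← hoff j' hj' hjj]; exact hubx j' hj'
  · obtain ⟨hoff, ej, ef⟩ := hs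
    refine ⟨fun j' hj' => ?_, topf ef⟩
    by_cases hjj : j' = j
    · subst hjj; exact atj ej
    · rw [← hoff j' hjj hj']; exact hubx j' hj'

/-- hence, under `¬ TouchesN c D` with `0 < c`, every supported P-cell touching co-level `c` HAS such a supplier (RULE D applied to the detecting
block `(f, j)` for any `j ≠ f`): an N-cell `(X⁻, hub, hub, hub)` with `NullStep (x f) X⁻`. -/
theorem exists_null_hub_supplier_of_not_touchesN {h : ℤ} {D : Design} (hA : D.OnAlphabet h) (hr : RuleDP D) {c : ℤ} (hc : 0 < c)
    (hN : ¬ TouchesN c D) {x : Cell} (hx : x ∈ D.suppP) {f : Fin 4} (hf : (x f).colevel = c) :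
    ∃ y ∈ D.suppN, (∀ j' : Fin 4, j' ≠ f → y j' = Letter.hub h) ∧ NullStep (x f) (y f) := by
  obtain ⟨j, hjf, -⟩ := exists_third_slot f f
  obtain ⟨y, hy, hs⟩ := ruleDP_any hr hx (Ne.symm hjf) (detects_top_slot hA hc hx hf j)
  exact ⟨y, hy, supplier_shape_of_not_touchesN hA hr hN hx hf hy hjf (Or.inl hs)⟩

/-! ## §3 At the ceiling of a ring room -/

/-- **(P-TOP AT THE CEILING).**  In a `RingLe c` room (`0 < c`) whose N side does not reach the ceiling co-level `c`, every supported P-cell is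
either strictly below the ceiling at every slot or of the form `(X, hub, hub, hub)` with `X` of co-level `c` — the design's ceiling column is carried
by three-hub P-cells only.  (The converse bookkeeping, an N-letter at the ceiling ⇒ a P-letter at the ceiling, is `DeepLayerLaws.touchesP_of_touchesN'`.) -/
theorem topP_three_hubs_of_not_touchesN_ceiling {h c : ℤ} {D : Design} (hA : D.OnAlphabet h) (hr : RuleD D) (hR : RingLe c D)
    (hN : ¬ TouchesN c D) {x : Cell} (hx : x ∈ D.suppP) :
    (∀ f : Fin 4, (x f).colevel < c) ∨ ∃ f : Fin 4, (x f).colevel = c ∧ ∀ j : Fin 4, j ≠ f → x j = Letter.hub h := by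
  by_cases htop : ∃ f : Fin 4, (x f).colevel = c
  · obtain ⟨f, hf⟩ := htop
    exact Or.inr ⟨f, hf, fun j hj => eq_hub_of_not_touchesN hA hr.2 hN hx hf hj⟩
  · push Not at htop
    exact Or.inl fun f => lt_of_le_of_ne (hR x (mem_supp_of_memP D hx) f) (htop f)

end Summit.HodgeConjecture.HodgeConjecture.Cruxes.BlochSeedDiscOne.ThreadCollapse
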